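import Summits.CriticalPhenomena.PercolationContinuityZ3.Theorems.PercNearOneGluingNoHeavyLowerTailSahiCTCLadderThreeRowThreeDegree
import Summits.CriticalPhenomena.PercolationContinuityZ3.Theorems.PercNearOneGluingNoHeavyLowerTailSahiCTCLadderThreeRowThreeCaseI
import HarnessLib

/-!
# `NoHeavyLowerTail` (crux stmt-CriticalPhenomena-4575), P3 lane: the per-family facts of the row `#dbl = 3` of `(L_3)` (Case II data)

Support file (seat `prim-l12-p3`, gen 26; `--supports stmt-CriticalPhenomena-4575`).  Paper proof `prim-l12-p3/ROW3-PROOF-g26.md` §5.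
With `cE m d = #{y ∈ T : y + (D∖d) ∈ 𝒳 ∩ 𝒵}` (the size `c` of the C-set of the pair `D∖d`): the C-set of the link at `d` seen from `x`
is the C-set of the pair `{d,x} = D∖x'` (`card_csetL2_eq_cE`), `#WC₂ ≤ Σ_d cE d` (`card_WC2_le_sum_cE`), two C-sets meeting in ≤ 1
point have total size ≤ τ+1 (`card_add_card_le_of_inter_le_one`), three of them pairwise so have total size ≤ τ+3
(`card_three_le_of_pairwise`), and the DEGREE-type family bound with the Q-data eliminated
(`psi_family_bound`: `(2τ−4)(Σ_{y₀}κ₂(d,y₀) − q_d) ≥ (2τ + (τ−1)·c)(τ−4) + τ(τ+1)` for each of the two C-sizes `c` the family sees).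
Nothing is asserted about the crux.
-/

namespace Summit.CriticalPhenomena.PercolationContinuityZ3.Theorems.SahiCTCForms

open Finset MvPolynomial SahiCTCGenFun SahiCTCWeightedLYM

variable {α : Type*} [DecidableEq α] [Fintype α]

section RowThreeFacts
variable {𝒳 𝒵 : Finset (Finset α)}

/-- `c(D∖d) = #{y ∈ T : y + (D∖d) ∈ 𝒳 ∩ 𝒵}`. [this work] -/
def cE (𝒳 𝒵 : Finset (Finset α)) (m : α →₀ ℕ) (d : α) : ℕ :=
  #((lev m 1).filter fun y => insert y ((dbl m).erase d) ∈ 𝒳 ∧ insert y ((dbl m).erase d) ∈ 𝒵)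

omit [Fintype α] in
/-- For the three points `d, x, x'` of `D`: the C-set of the link at `d` seen from `x` is the C-set of the pair `D∖x'`. [this work] -/
theorem csetL2_eq_filter_erase {m : α →₀ ℕ} (hD : #(dbl m) = 3) {d x x' : α} (hd : d ∈ dbl m) (hx : x ∈ dbl m) (hx' : x' ∈ dbl m)
    (hdx : d ≠ x) (hdx' : d ≠ x') (hxx' : x ≠ x') :
    csetL2 𝒳 𝒵 m d x = (lev m 1).filter fun y => insert y ((dbl m).erase x') ∈ 𝒳 ∧ insert y ((dbl m).erase x') ∈ 𝒵 := by
  have heq : (dbl m).erase x' = {d, x} := by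
    apply (eq_of_subset_of_card_le _ _).symm
    · intro i hi
      rcases mem_insert.1 hi with rfl | hi
      · exact mem_erase.2 ⟨hdx', hd⟩
      · rw [mem_singleton.1 hi]; exact mem_erase.2 ⟨hxx', hx⟩
    · rw [card_erase_of_mem hx', hD, card_pair hdx]
  unfold csetL2
  refine filter_congr fun y _ => ?_
  rw [heq, show insert y ({d, x} : Finset α) = insert d {x, y} from by
    ext i; simp only [mem_insert, mem_singleton]; tauto]

omit [Fintype α] in
/-- Hence `#csetL2 m d x = cE m x'`. [this work] -/
theorem card_csetL2_eq_cE {m : α →₀ ℕ} (hD : #(dbl m) = 3) {d x x' : α} (hd : d ∈ dbl m) (hx : x ∈ dbl m) (hx' : x' ∈ dbl m)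
    (hdx : d ≠ x) (hdx' : d ≠ x') (hxx' : x ≠ x') : #(csetL2 𝒳 𝒵 m d x) = cE 𝒳 𝒵 m x' := by
  unfold cE; rw [csetL2_eq_filter_erase hD hd hx hx' hdx hdx' hxx']

omit [Fintype α] in
/-- `#WC₂ ≤ Σ_{d ∈ D} c(D∖d)` when `W ⊆ 𝒳 ∩ 𝒵` (`#D = 3`). [this work] -/
theorem card_WC2_le_sum_cE {m : α →₀ ℕ} (hm : ∀ i, m i ≤ 2) (hD : #(dbl m) = 3) (W : Finset (Finset α)) (hW3 : ∀ w ∈ W, #w = 3)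
    (hW : ∀ S ∈ W, S ∈ 𝒳 ∧ S ∈ 𝒵) :
    #((W.filter fun w => ind w ≤ m).filter fun w => #(dbl m ∩ w) = 2) ≤ ∑ d ∈ dbl m, cE 𝒳 𝒵 m d := by
  refine (card_WC_le_sum hm W hW3).trans ?_
  have himage : (dbl m).powersetCard 2 = (dbl m).image fun d => (dbl m).erase d := by
    ext p; simp only [mem_powersetCard, mem_image]
    constructor
    · rintro ⟨hpD, hp2⟩
      have h1 : #(dbl m \ p) = 1 := by rw [card_sdiff_of_subset hpD, hp2, hD]
      obtain ⟨d, hd⟩ := card_eq_one.1 h1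
      have hdD : d ∈ dbl m \ p := by rw [hd]; exact mem_singleton_self d
      refine ⟨d, (mem_sdiff.1 hdD).1, ?_⟩
      rw [erase_eq, ← hd, Finset.sdiff_sdiff_eq_self hpD]
    · rintro ⟨d, hd, rfl⟩
      exact ⟨erase_subset _ _, by rw [card_erase_of_mem hd, hD]⟩
  rw [himage, sum_image fun d hd d' hd' h => erase_injOn (dbl m) hd hd' h]
  refine sum_le_sum fun d _ => card_le_card fun y hy => ?_
  obtain ⟨hyT, hyW⟩ := mem_filter.1 hy
  exact mem_filter.2 ⟨hyT, hW _ hyW⟩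

omit [Fintype α] in
/-- Two subsets of `T` meeting in at most one point have total size `≤ τ + 1`. [folklore] -/
theorem card_add_card_le_of_inter_le_one {T A B : Finset α} (hA : A ⊆ T) (hB : B ⊆ T) (h : #(A ∩ B) ≤ 1) :
    #A + #B ≤ #T + 1 := by
  have h1 := card_union_add_card_inter A B
  have h2 : #(A ∪ B) ≤ #T := card_le_card (union_subset hA hB)
  omega

omit [Fintype α] in
/-- Three subsets of `T` pairwise meeting in at most one point have total size `≤ τ + 3`. [folklore] -/
theorem card_three_le_of_pairwise {T A B C : Finset α} (hA : A ⊆ T) (hB : B ⊆ T) (hC : C ⊆ T) (hAB : #(A ∩ B) ≤ 1)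
    (hAC : #(A ∩ C) ≤ 1) (hBC : #(B ∩ C) ≤ 1) : #A + #B + #C ≤ #T + 3 := by
  have h1 := card_union_add_card_inter A B
  have h2 := card_union_add_card_inter (A ∪ B) C
  have h3 : #(A ∪ B ∪ C) ≤ #T := card_le_card (union_subset (union_subset hA hB) hC)
  have h4 : #((A ∪ B) ∩ C) ≤ 2 := by
    rw [union_inter_distrib_right]
    exact (card_union_le _ _).trans (by omega)
  omega

/-- **DEGREE-type family bound with the Q-data eliminated**: if `D ∈ 𝒳 ∩ 𝒵`, then for `d ∈ D`, `x ∈ D∖d` and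
`q_d = #qset m d`: `(2τ−4)(Σ_{y₀} κ₂(d,y₀) − q_d) ≥ (2τ + (τ−1)·#csetL2 m d x)(τ−4) + τ(τ+1)` (`τ ≥ 4`). [this work] -/
theorem psi_family_bound (h𝒳 : IsUpperSet (𝒳 : Set (Finset α))) (h𝒵 : IsUpperSet (𝒵 : Set (Finset α)))
    (hX3 : ∀ S ∈ 𝒳, 3 ≤ #S) (hZ3 : ∀ S ∈ 𝒵, 3 ≤ #S) {m : α →₀ ℕ} (hD : #(dbl m) = 3) (hτ : 4 ≤ #(lev m 1)) {d : α} (hd : d ∈ dbl m)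
    {x : α} (hx : x ∈ (dbl m).erase d) (hDX : dbl m ∈ 𝒳) (hDZ : dbl m ∈ 𝒵) :
    (2 * (#(lev m 1) : ℤ) + (#(lev m 1) - 1) * #(csetL2 𝒳 𝒵 m d x)) * (#(lev m 1) - 4) + #(lev m 1) * (#(lev m 1) + 1) ≤
      (2 * (#(lev m 1) : ℤ) - 4) * (∑ y₀ ∈ lev m 1, kapL2 𝒳 𝒵 m d y₀ - #(qset 𝒳 𝒵 m d)) := by
  have hT : (lev m 1).Nonempty := card_pos.1 (by omega)
  obtain ⟨v, hv, hmax⟩ := exists_max_image (lev m 1) (qdeg 𝒳 𝒵 m d) hT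
  have hL0 := sum_kapL2_ge_deg_alpha h𝒳 h𝒵 hX3 hZ3 hD (by omega) hd hx hDX hDZ
  have hTd := sum_kapL2_ge_tdeg_alpha h𝒳 h𝒵 hX3 hZ3 hD (by omega) hd hDX hDZ hv
  have hq : 2 * (#(qset 𝒳 𝒵 m d) : ℤ) ≤ #(lev m 1) * (qdeg 𝒳 𝒵 m d v : ℤ) := by
    exact_mod_cast two_mul_card_qset_le m d hmax
  exact psi_one_bound (by exact_mod_cast hτ) hL0 (by linarith) hq

end RowThreeFacts

end Summit.CriticalPhenomena.PercolationContinuityZ3.Theorems.SahiCTCForms
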